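import Mathlib
import HarnessLib.Audit

/-!
# Crux E `PowerGaugeEulerLiouville` (stmt-NavierStokesRegularity-19832), line `swirl-capacity`, stub D2 — part 1:
# THE PLANAR SOBOLEV FLOOR (a `C¹` compactly supported function on `ℝ²` which is `≥ γ₀` on a set of area `σ` has Dirichlet energy
# `≳_q γ₀² (σ/|B|)^{2/q}`)

Route `EulerZoomLiouville` (NavierStokesRegularity), crux E.  Line `swirl-capacity` (ideator ns-idea-11 g3, LINE D;
`Cruxes/PowerGaugeEulerLiouville/Lines/swirl_capacity.lean`), stub D2 `stub_axisCapacityFloor` in the POWER-LOSSY form of the critic's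
escape hatch (idea-crit-8 g2 V29, price P3: `∫_{B(3A)}|∇f|²/r² ≥ K_θ γ₀² (V/A³)^θ / A` for each fixed `θ = 2/q`, which wins the line's exponent
race with the same threshold).  THIS FILE is the two-dimensional core, with no fluid mechanics in it:

* `planar_superlevel_floor` — for every exponent `q ≥ 2` there is a constant `C_q` (Mathlib's Gagliardo–Nirenberg–Sobolev constant of the
  plane `ℝ × ℝ` at `p = 2q/(q+2)`) such that for every `C¹` compactly supported `h : ℝ × ℝ → ℝ` with `tsupport h ⊆ B`, every measurable `S` and
  `γ₀ > 0` with `h ≥ γ₀` on `S`:  `γ₀² · |S|^{2/q} ≤ C_q² · |B|^{2/q} · ∫ ‖∇h‖²`.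
  Proof: `γ₀ |S|^{1/q} ≤ ‖h‖_q` (the indicator of `S` is dominated by `h`); Gagliardo–Nirenberg–Sobolev on the plane
  (`MeasureTheory.eLpNorm_le_eLpNorm_fderiv_of_eq_inner`, `n = 2`, `1/q = 1/p − 1/2`): `‖h‖_q ≤ C_q ‖∇h‖_p`; Hölder on `B`
  (`eLpNorm_le_eLpNorm_mul_rpow_measure_univ`): `‖∇h‖_p ≤ ‖∇h‖_2 |B|^{1/p − 1/2} = ‖∇h‖_2 |B|^{1/q}`; square.

The logarithm of the registered log-sharp floor would need the sharp growth `C_q ∼ √q`; Mathlib's constant grows like `q`, which is why the line is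
re-cut to the power-lossy form (parts 2–4: meridional reduction and ray Poincaré from the grounded axis; the velocity form; the endgame).

WHAT THIS IS NOT: not NS regularity, not the crux E — a helper `--supports` stmt-19832 (pure real analysis) for a stratum statement about a
hypothetical Euler zoom-limit class.  [folklore; Gagliardo 1958 / Nirenberg 1959 (the Sobolev inequality), Mathlib `SobolevInequality`]
-/

noncomputable section

set_option linter.dupNamespace false

open MeasureTheory Set Filter Topology Metric Function
open scoped NNReal ENNReal

namespace Summit.NavierStokesRegularity.NavierStokesRegularity.Theorems.PowerGaugeEulerLiouville.SwirlCapacity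

/-- The plane `ℝ × ℝ` has dimension `2`. [folklore] -/
theorem finrank_real_prod_self : Module.finrank ℝ (ℝ × ℝ) = 2 := by
  simp

/-- **THE PLANAR SOBOLEV FLOOR.**  For `q ≥ 2` there is `C` (Mathlib's planar Gagliardo–Nirenberg–Sobolev constant at `p = 2q/(q+2)`) with:
for every `C¹` compactly supported `h : ℝ × ℝ → ℝ` with `tsupport h ⊆ B` (`B` measurable), every measurable `S` and every `γ₀ > 0` such that
`h ≥ γ₀` on `S`,  `γ₀² |S|^{2/q} ≤ C² |B|^{2/q} ∫ ‖∇h‖²` (in `ℝ≥0∞`; Mathlib's `MeasureTheory.eLpNorm_le_eLpNorm_fderiv_of_eq_inner`).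
[folklore] -/
theorem planar_superlevel_floor {q : ℝ≥0} (hq : 2 ≤ q) :
    ∃ C : ℝ≥0, ∀ (h : ℝ × ℝ → ℝ) (B S : Set (ℝ × ℝ)) (γ₀ : ℝ), ContDiff ℝ 1 h → HasCompactSupport h → tsupport h ⊆ B →
      MeasurableSet B → MeasurableSet S → 0 < γ₀ → (∀ y ∈ S, γ₀ ≤ h y) →
        ENNReal.ofReal γ₀ ^ (2 : ℝ) * volume S ^ (2 / (q : ℝ)) ≤
          (C : ℝ≥0∞) ^ (2 : ℝ) * volume B ^ (2 / (q : ℝ)) * ∫⁻ y, ‖fderiv ℝ h y‖ₑ ^ (2 : ℝ) := by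
  -- the exponent `p = 2q/(q+2) ∈ [1, 2)` with `1/q = 1/p - 1/2`
  have hq0 : (0 : ℝ) < q := by
    have : (2 : ℝ) ≤ q := by exact_mod_cast hq
    linarith
  set p : ℝ≥0 := 2 * q / (q + 2) with hp
  have hpR : (p : ℝ) = 2 * q / (q + 2) := by rw [hp]; push_cast; ring
  have hp1 : 1 ≤ p := by
    rw [← NNReal.coe_le_coe, NNReal.coe_one, hpR, le_div_iff₀ (by positivity)]
    have : (2 : ℝ) ≤ q := by exact_mod_cast hq
    linarith
  have hp2 : p ≤ 2 := by
    rw [← NNReal.coe_le_coe, hpR, div_le_iff₀ (by positivity)]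
    push_cast
    nlinarith
  have hp0 : (0 : ℝ) < p := by rw [hpR]; positivity
  have hpq : (q : ℝ)⁻¹ = (p : ℝ)⁻¹ - (Module.finrank ℝ (ℝ × ℝ) : ℝ)⁻¹ := by
    rw [finrank_real_prod_self, hpR]
    push_cast
    field_simp
    ring
  have hpq' : 1 / (p : ℝ) - 1 / 2 = 1 / (q : ℝ) := by
    rw [one_div, one_div, one_div, hpq, finrank_real_prod_self]
    push_cast
    ring
  refine ⟨eLpNormLESNormFDerivOfEqInnerConst (volume : Measure (ℝ × ℝ)) p, fun h B S γ₀ hh hsupp hB hBm hSm hγ₀ hS => ?_⟩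
  set C : ℝ≥0 := eLpNormLESNormFDerivOfEqInnerConst (volume : Measure (ℝ × ℝ)) p with hC
  -- (1) Gagliardo–Nirenberg–Sobolev on the plane
  have hgns : eLpNorm h q volume ≤ (C : ℝ≥0∞) * eLpNorm (fderiv ℝ h) p volume :=
    eLpNorm_le_eLpNorm_fderiv_of_eq_inner (volume : Measure (ℝ × ℝ)) hh hsupp hp1 (by rw [finrank_real_prod_self]; norm_num) hpq
  -- (2) Hölder on `B`: `‖∇h‖_p ≤ ‖∇h‖_2 |B|^{1/q}`
  have hsuppD : support (fderiv ℝ h) ⊆ B :=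
    (subset_tsupport _).trans ((tsupport_fderiv_subset ℝ).trans hB)
  have hrestr : ∀ r : ℝ≥0∞, eLpNorm (fderiv ℝ h) r (volume.restrict B) = eLpNorm (fderiv ℝ h) r volume :=
    fun r => eLpNorm_restrict_eq_of_support_subset (μ := (volume : Measure (ℝ × ℝ))) (p := r) (f := fderiv ℝ h) hsuppD
  have hholder : eLpNorm (fderiv ℝ h) p volume ≤ eLpNorm (fderiv ℝ h) 2 volume * volume B ^ (1 / (q : ℝ)) := by
    rw [← hrestr p, ← hrestr 2]
    have hm : AEStronglyMeasurable (fderiv ℝ h) (volume.restrict B) :=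
      (hh.continuous_fderiv one_ne_zero).aestronglyMeasurable
    have h1 := eLpNorm_le_eLpNorm_mul_rpow_measure_univ (μ := volume.restrict B) (p := (p : ℝ≥0∞)) (q := 2)
      (by exact_mod_cast hp2) hm
    rw [Measure.restrict_apply_univ] at h1
    have e : 1 / (p : ℝ≥0∞).toReal - 1 / (2 : ℝ≥0∞).toReal = 1 / (q : ℝ) := by
      rw [ENNReal.coe_toReal, ENNReal.toReal_ofNat, hpq']
    rwa [e] at h1
  -- (3) the superlevel set: `γ₀ |S|^{1/q} ≤ ‖h‖_q`
  have hqne : (q : ℝ≥0∞) ≠ 0 := by exact_mod_cast hq0.ne'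
  have hlow : ENNReal.ofReal γ₀ * volume S ^ (1 / (q : ℝ)) ≤ eLpNorm h q volume := by
    have h1 : eLpNorm (S.indicator fun _ => γ₀) q volume = ‖γ₀‖ₑ * volume S ^ (1 / (q : ℝ≥0∞).toReal) :=
      eLpNorm_indicator_const hSm hqne ENNReal.coe_ne_top
    rw [ENNReal.coe_toReal, Real.enorm_eq_ofReal hγ₀.le] at h1
    rw [← h1]
    refine eLpNorm_mono fun y => ?_
    by_cases hy : y ∈ S
    · rw [indicator_of_mem hy, Real.norm_eq_abs, abs_of_pos hγ₀, Real.norm_eq_abs]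
      exact (hS y hy).trans (le_abs_self _)
    · rw [indicator_of_notMem hy, norm_zero]
      exact norm_nonneg _
  -- (4) chain and square
  have hchain : ENNReal.ofReal γ₀ * volume S ^ (1 / (q : ℝ)) ≤
      (C : ℝ≥0∞) * volume B ^ (1 / (q : ℝ)) * eLpNorm (fderiv ℝ h) 2 volume :=
    calc ENNReal.ofReal γ₀ * volume S ^ (1 / (q : ℝ)) ≤ eLpNorm h q volume := hlow
      _ ≤ (C : ℝ≥0∞) * eLpNorm (fderiv ℝ h) p volume := hgns
      _ ≤ (C : ℝ≥0∞) * (eLpNorm (fderiv ℝ h) 2 volume * volume B ^ (1 / (q : ℝ))) := by gcongr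
      _ = (C : ℝ≥0∞) * volume B ^ (1 / (q : ℝ)) * eLpNorm (fderiv ℝ h) 2 volume := by ring
  have hsq := ENNReal.rpow_le_rpow hchain (show (0 : ℝ) ≤ 2 by norm_num)
  have e1 : (ENNReal.ofReal γ₀ * volume S ^ (1 / (q : ℝ))) ^ (2 : ℝ) =
      ENNReal.ofReal γ₀ ^ (2 : ℝ) * volume S ^ (2 / (q : ℝ)) := by
    rw [ENNReal.mul_rpow_of_nonneg _ _ (by norm_num : (0 : ℝ) ≤ 2), ← ENNReal.rpow_mul]
    congr 2
    ring
  have e2 : ((C : ℝ≥0∞) * volume B ^ (1 / (q : ℝ)) * eLpNorm (fderiv ℝ h) 2 volume) ^ (2 : ℝ) =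
      (C : ℝ≥0∞) ^ (2 : ℝ) * volume B ^ (2 / (q : ℝ)) * ∫⁻ y, ‖fderiv ℝ h y‖ₑ ^ (2 : ℝ) := by
    rw [ENNReal.mul_rpow_of_nonneg _ _ (by norm_num : (0 : ℝ) ≤ 2),
      ENNReal.mul_rpow_of_nonneg _ _ (by norm_num : (0 : ℝ) ≤ 2), ← ENNReal.rpow_mul]
    have h2 : eLpNorm (fderiv ℝ h) 2 volume ^ (2 : ℝ) = ∫⁻ y, ‖fderiv ℝ h y‖ₑ ^ (2 : ℝ) := by
      have := eLpNorm_nnreal_pow_eq_lintegral (μ := (volume : Measure (ℝ × ℝ))) (f := fderiv ℝ h) (p := (2 : ℝ≥0)) two_ne_zero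
      push_cast at this
      exact this
    rw [h2]
    congr 2
    ring
  rwa [e1, e2] at hsq

end Summit.NavierStokesRegularity.NavierStokesRegularity.Theorems.PowerGaugeEulerLiouville.SwirlCapacity

end
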